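import Mathlib
import Literature.NumberTheory.LFunctions.CharZeroSum
import HarnessLib

/-!
# Conrey–Iwaniec–Soundararajan, *Critical zeros of Dirichlet `L`-functions* (arXiv:1105.1177,
# Crelle 681 (2013)), §1: Theorem 1 (`56%` of the zeros of the family are simple and critical),
# Theorem 2 (the mollified second moment with mollifier length `X = 𝐪^θ`, `0 < θ < 1`), and the
# Levinson deduction (1.24)–(1.25)

Topic `Literature/NumberTheory/LFunctions` (namespace `Literature.NumberTheory.LFunctions`; the
paper's objects — `N(T,χ)`, `N₀′(T,χ)`, `𝒩(T,Q)`, `G = L + λL′`, the mollifier `M(s,χ)`, `I_χ`,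
`c(θ,r,R)`, `κ′` — live in the sub-namespace `CISCriticalZeros`). STATEMENT LAYER (D-0014): three
NAMED FACTS (`def … : Prop`, status theorem-in-print) over honest definitions; the zero vocabulary is
the tree's (`ExplicitPsiChar.charNontrivialZeros χ` = the non-trivial zeros of `L(s,χ)`, multiplicity
`DirichletDisc.zeroOrder χ ρ`, file `CharZeroSum.lean` — CITED, nothing about zeros re-declared) and
Mathlib's (`DirichletCharacter.LFunction`, `IsPrimitive`, `ArithmeticFunction.moebius`). Typed for
the Landau–Siegel programme (rung F-S3, §C harvest; §B-len START-HERE): this is THE printed use of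
the asymptotic large sieve (`AsymptoticLargeSieve.lean`, Theorem 2.4) for mollifiers of length
`X = 𝐪^θ` with `θ < 1` — "It seems we reached the limit of the mollification technology, with respect
to the length, because it is unlikely that a mollifier longer than the size of the conductor can be
worked out unconditionally" (§1) — i.e. the `θ < 1` side of the knife edge E*-len, ON AVERAGE over
`χ (mod q)` and `q ≍ Q`. No claim about a single modulus or about exceptional characters.

## What the source prints (held text `paper:arxiv-1105.1177`, corpus-tex chunks p0001–p0005, read
## 2026-08-26; the extractor prints equation (1.k) as "(1k)" and drops theorem head-words — the two
## main statements are the source's `\ref{theorem1}` = display (1.5) and `\ref{theorem2}` = (1.17))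

J. B. Conrey, H. Iwaniec, K. Soundararajan, *Critical zeros of Dirichlet `L`-functions*,
arXiv:1105.1177, J. reine angew. Math. **681** (2013) 175–198 [ConreyIwaniecSoundararajan2011CriticalZeros].

§1 (p0002–p0003): "Let `χ (mod q)` be a primitive character. The total number of zeros `ρ = β + iγ`
of `L(s,χ)` with `0 < β < 1` and `|γ| ≤ T`, say `N(T,χ)` … Denote by `N₀′(T,χ)` the number of simple
zeros of `L(s,χ)`, `ρ = 1/2 + iγ` with `|γ| ≤ T`, so `N₀(T,χ) ≥ N₀′(T,χ)`. Let `Ψ(x)` be a non-negative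
function, smooth, compactly supported on `ℝ⁺`. Put `𝒩(T,Q) = Σ_q Ψ(q/Q)/φ(q) Σ*_{χ (mod q)} N(T,χ)`
(1.4) where `Q ≥ 3` and `T ≥ 3`. Here the superscript `*` restricts the summation to the primitive
characters. Let `𝒩₀′(T,Q)` denote the same sum, but with `N(T,χ)` replaced by `N₀′(T,χ)`."

> **Theorem 1** (`theorem1`, p0003:L1–8). For `Q` and `T` with `(log Q)^6 ≤ T ≤ (log Q)^A` we have
> `𝒩₀′(T,Q) ≥ (14/25) 𝒩(T,Q)` (1.5), where `A ≥ 6` is any constant, provided `Q` is sufficiently large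
> in terms of `A`.

"Likewise we take `G(s,χ) = L(s,χ) + λL′(s,χ)` (1.6) with `λ = 1/r log 𝐪`, where `r` is a positive
constant and … `𝐪 = q/π` (1.7)." "`M(s,χ) = Σ_{m ≤ X} μ(m)χ(m)m^{−s} P(1 − log m/log X)` (1.9) where
`P(x)` is a smooth function with `P(0) = 0` and `P(1) = 1`." "`I_χ = ∫ |G(σ+it,χ) M(½+it,χ)|² Φ(t) dt`
(1.10) … We assume that `Φ(t)` is smooth, `Φ(t) ≥ 0` with `Φ̂(1) = ∫_{−∞}^{∞} Φ(t) dt > 0` (1.11) and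
`(1+|t|)^j Φ^{(j)}(t) ≪ (1 + |t|/T)^{−A}` (1.12) for any `j ≥ 0` and any `A ≥ 0`, the implied constant
depending on `j` and `A`. … in general we think of having `Φ(t)` with `Φ̂(1) ≍ T`."
"For simplicity in this paper we take (1.9) with `P(x) = x`, that is
`M(s,χ) = Σ_{m ≤ X} μ(m)χ(m)m^{−s}(1 − log m/log X)` (1.16). In this special case we prove

> **Theorem 2** (`theorem2`, p0004:L1–12). Let `X = 𝐪^θ` with `0 < θ < 1`, `λ = 1/r log 𝐪` with
> `r > 0` and `σ = ½ − R/log 𝐪` with `R > 0`. Then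
> `Σ_q Ψ(q/Q)/φ(q) Σ*_{χ (mod q)} I_χ ∼ c(θ,r,R) Φ̂(1) Σ_q Ψ(q/Q) φ(q*)/φ(q)` (1.17)
> in the range `(log Q)^6 ≤ T ≤ (log Q)^A`, as `Q → ∞`. Here the constant `c(θ,r,R)` is given by
> `r² c(θ,r,R) = C(θ,r,R) + e^{2R} C*(θ,r,R)` (1.18) with
> `C(θ,r,R) = −(r²/2 + 1/(4R²))(1/(θR) + θR/3) + r²/2 − (r/2R)(1/(θR) − θR/3)` (1.19)
> and `C*(θ,r,R)` is obtained from `C(θ,r,R)` by changing `r, R` to `1−r, −R` respectively; that is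
> `C*(θ,r,R) = ((r−1)²/2 + 1/(4R²))(1/(θR) + θR/3) + (r−1)²/2 + ((r−1)/2R)(1/(θR) − θR/3)` (1.20).

(`φ(q*)` in (1.17) is the source's typography for `φ*(q)`, "the number of primitive characters,
`φ* = μ ∗ φ`" of (1.14); the right-hand side of (1.17) is `c · Φ̂(1) · Σ_q Ψ(q/Q) φ*(q)/φ(q)`, the
`Ψ/φ`-weighted count of the family, exactly as (1.14) is normalised by `φ*(q)`.)

"Now it is quick to derive Theorem 1 from Theorem 2. By Corollary A in the last section we get
`𝒩₀′(T,Q) ≥ (κ′ + o(1)) 𝒩(T,Q)` (1.24) for `(log Q)^6 ≤ T ≤ (log Q)^A`, `Q → ∞`, where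
`κ′ = 1 − (1/R) log c(θ,r,R)` (1.25). For `θ = 1`, `r = 10/9` and `R = 0.83` this yields
`c(θ,r,R) = 1.44079…` and `κ′ = 0.56001…`." (p0004:L40–48.) "Numerically the best values are
`a = 1.3408`, `r^{−1} = 0.94` and `R = 0.75` giving (1.24) with `κ′ = 0.5865` (1.26)" [for the optimal
`P(x) = sinh(ax)/sinh a`, not the linear `P` of (1.16)]. "With the amount of averaging `φ*(q)` we
can accept mollifiers of length `X = q^{1/2−ε}` … In this paper we introduce further averaging over
the conductor `q` … This improvement comes from the fact that our mollifier has length `X = q^{1−ε}`.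
It seems we reached the limit of the mollification technology, with respect to the length, because
it is unlikely that a mollifier longer than the size of the conductor can be worked out
unconditionally without recourse to the Riemann Hypothesis." (p0003:L60–70.)

## Lean rendering / design choices

* ZEROS. `N(T,χ) = Σ_{ρ : L(ρ,χ)=0, 0<Re ρ<1, |Im ρ| ≤ T} m(ρ)` is the `finsum` of the tree's
  multiplicity `DirichletDisc.zeroOrder χ` over the tree's `ExplicitPsiChar.charNontrivialZeros χ`
  truncated at `|Im ρ| ≤ T` (`zeroCount`; the set is finite — `lfunctionZeroBox_finite` — so the
  `finsum` is the printed count with multiplicity, the convention of (1.2)). `N₀′(T,χ)` is the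
  `Set.ncard` of the simple (`m(ρ) = 1`) zeros with `Re ρ = 1/2`, `|Im ρ| ≤ T`
  (`simpleCriticalZeroCount`).
* FAMILY. As in `AsymptoticLargeSieve.lean`: `Σ*_{χ (mod q)}` is the `Finset` sum over
  `χ : DirichletCharacter ℂ q` with `χ.IsPrimitive`; the `q`-sum is a `finsum` indexed by
  `q = k + 1` (so that `[NeZero q]`, needed by `DirichletCharacter.LFunction`, is automatic); for `Ψ`
  compactly supported in `(0,∞)` it is the printed finite sum. "`Ψ` non-negative, smooth, compactly
  supported on `ℝ⁺`" = `IsNonnegFamilyWeight`.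
* `G`, `M`, `I_χ`: `levinsonG r χ s = L(s,χ) + (r log 𝐪)⁻¹ L′(s,χ)` with Mathlib's `deriv` of
  `χ.LFunction`; `mollifier X χ s` is (1.16) verbatim (`μ = ArithmeticFunction.moebius`, `m^{−s}` the
  principal complex power); `mollifiedMoment r X σ Φ χ = ∫ ‖G(σ+it)M(½+it)‖² Φ(t) dt` (Bochner integral
  over `ℝ`; the integrand is continuous and, by (1.12), rapidly decaying, so it is integrable).
* `Φ`. (1.11)–(1.12) with "`Φ̂(1) ≍ T`": the class `IsHeightWeight T c Φ` = smooth, `Φ ≥ 0`,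
  `|(1+|t|)^j Φ^{(j)}(t)| ≤ c(j,A) (1+|t|/T)^{−A}` for all `j, A ∈ ℕ` (a constants TABLE `c`, since the
  theorem is uniform over `Φ` only for fixed implied constants; integer `A` suffice, each real `A ≥ 0`
  being dominated by `⌈A⌉`), and the lower comparability `c₁ T ≤ Φ̂(1)` is an explicit hypothesis of the
  typed Theorem 2 (the source's "we think of having `Φ̂(1) ≍ T`"; the upper bound `Φ̂(1) ≪ T` follows
  from (1.12)). This only NARROWS the class of `Φ`, never strengthens the fact.
* "`LHS ∼ c · RHS` in the range `(log Q)^6 ≤ T ≤ (log Q)^A`, as `Q → ∞`" = for every `ε > 0` there is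
  `Q₀` (depending on `Ψ, θ, r, R, A, c, c₁, ε`) with `|LHS − c·RHS| ≤ ε·RHS-scale` for all `Q ≥ Q₀`, all
  `T` in the range and all admissible `Φ` (`…_theorem2`). Theorem 1 = `∃ Q₀(A, Ψ), ∀ Q ≥ Q₀, ∀ T` in
  the range, `(14/25)·𝒩(T,Q) ≤ 𝒩₀′(T,Q)` (`…_theorem1`). (1.24)–(1.25) = `…_levinsonBound`, typed for
  the parameters of Theorem 2 (`0 < θ < 1`) with the side condition `c(θ,r,R) > 0` made explicit (the
  source: "Definitely `c > 1`"; `Real.log` of a non-positive number is junk).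
* `c(θ,r,R)`, `C`, `C*`, `κ′` are closed-form real definitions; `C*` is DEFINED by the printed rule
  "change `r, R` to `1−r, −R`" and PROVED equal to the printed display (1.20) (`bigCStar_eq`).
* No instances, no notation; imports `CharZeroSum` (zero vocabulary) + Mathlib.

## Deliberately not here

* The `GL₂`/`GL₃` theorem of §1 ((1.27)–(1.29): `𝒩′_{f,0}(T,Q) ≥ (7/20) 𝒩_f(T,Q)` for twists of a
  `GL₂` `L`-function, `≥ (1/200) 𝒩_f` for `GL₃`) — needs twisted automorphic `L`-functions and their
  zero counts; INDEX-ONLY here. -- TODO(general form).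
* The numerical evaluations `c(1,10/9,0.83) = 1.44079…`, `κ′ = 0.56001…`, `κ′ = 0.5865` (certified
  numerics would be needed; recorded in prose), Proposition A / Corollary A of the Appendix
  (Levinson's inequality in the `q`-aspect) except through their printed consequence (1.24), and
  §§2–7 (reduction to [CIS] = `AsymptoticLargeSieve.lean`).

References: [cite: ConreyIwaniecSoundararajan2011CriticalZeros, §1 Theorem 1 (1.5), Theorem 2
(1.16)–(1.20), (1.24)–(1.25)]; zero vocabulary [cite: MontgomeryVaughan2007, Corollary 10.8] via
`CharZeroSum`.

«The programme SEARCHES and TYPES; no claim about Landau–Siegel zeros, Theorems 1–2 of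
arXiv:2211.02515 or a repaired Margin232 until a kernel theorem says so.»
-/

noncomputable section

open scoped Classical ContDiff
open Complex Finset Filter MeasureTheory

namespace Literature.NumberTheory.LFunctions

namespace CISCriticalZeros

/-! ### Zero counts of one `L(s, χ)` -/

section OneCharacter

variable {q : ℕ} [NeZero q]

/-- `N(T,χ)`: the number of zeros `ρ = β + iγ` of `L(s,χ)` with `0 < β < 1` and `|γ| ≤ T`, counted
with multiplicity — the `finsum` of `m(ρ) = DirichletDisc.zeroOrder χ ρ` over the tree's non-trivial
zeros `ExplicitPsiChar.charNontrivialZeros χ` with `|Im ρ| ≤ T` (a finite set).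
[cite: ConreyIwaniecSoundararajan2011CriticalZeros, §1 (1.2) (definition of N(T,χ))] -/
def zeroCount (χ : DirichletCharacter ℂ q) (T : ℝ) : ℕ :=
  ∑ᶠ ρ ∈ {ρ : ℂ | ρ ∈ ExplicitPsiChar.charNontrivialZeros χ ∧ |ρ.im| ≤ T},
    DirichletDisc.zeroOrder χ ρ

/-- `N₀′(T,χ)`: the number of SIMPLE zeros `ρ = ½ + iγ` of `L(s,χ)` on the critical line with
`|γ| ≤ T` (`m(ρ) = 1`; each such zero counted once).
[cite: ConreyIwaniecSoundararajan2011CriticalZeros, §1 (definition of N₀′(T,χ))] -/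
def simpleCriticalZeroCount (χ : DirichletCharacter ℂ q) (T : ℝ) : ℕ :=
  Set.ncard {ρ : ℂ | ρ ∈ ExplicitPsiChar.charNontrivialZeros χ ∧ ρ.re = 1 / 2 ∧ |ρ.im| ≤ T ∧
    DirichletDisc.zeroOrder χ ρ = 1}

/-- A simple critical zero is in particular a non-trivial zero with `|γ| ≤ T`: the set counted by
`N₀′(T,χ)` is contained in the set summed over by `N(T,χ)`.
[cite: ConreyIwaniecSoundararajan2011CriticalZeros, §1 ("so N₀(T,χ) ≥ N₀′(T,χ)")] -/
theorem simpleCriticalZeros_subset (χ : DirichletCharacter ℂ q) (T : ℝ) :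
    {ρ : ℂ | ρ ∈ ExplicitPsiChar.charNontrivialZeros χ ∧ ρ.re = 1 / 2 ∧ |ρ.im| ≤ T ∧
        DirichletDisc.zeroOrder χ ρ = 1} ⊆
      {ρ : ℂ | ρ ∈ ExplicitPsiChar.charNontrivialZeros χ ∧ |ρ.im| ≤ T} := by
  intro ρ hρ
  exact ⟨hρ.1, hρ.2.2.1⟩

/-! ### `G = L + λL′`, the mollifier (1.16), the mollified moment `I_χ` -/

/-- `𝐪 = q/π` (1.7). [cite: ConreyIwaniecSoundararajan2011CriticalZeros, §1 (1.7)] -/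
def boldQ (q : ℕ) : ℝ :=
  (q : ℝ) / Real.pi

/-- `G(s,χ) = L(s,χ) + λ L′(s,χ)` with `λ = 1/(r log 𝐪)` (1.6).
[cite: ConreyIwaniecSoundararajan2011CriticalZeros, §1 (1.6)–(1.7)] -/
def levinsonG (r : ℝ) (χ : DirichletCharacter ℂ q) (s : ℂ) : ℂ :=
  χ.LFunction s + ((1 / (r * Real.log (boldQ q)) : ℝ) : ℂ) * deriv χ.LFunction s

/-- The linear mollifier (1.16): `M(s,χ) = Σ_{m ≤ X} μ(m) χ(m) m^{−s} (1 − log m / log X)`.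
[cite: ConreyIwaniecSoundararajan2011CriticalZeros, §1 (1.16)] -/
def mollifier (X : ℝ) (χ : DirichletCharacter ℂ q) (s : ℂ) : ℂ :=
  ∑ m ∈ Finset.Icc 1 ⌊X⌋₊,
    (ArithmeticFunction.moebius m : ℂ) * χ (m : ZMod q) * (m : ℂ) ^ (-s) *
      ((1 - Real.log m / Real.log X : ℝ) : ℂ)

/-- The mollified, smoothed second moment (1.10) on the line `Re s = σ`:
`I_χ = ∫ |G(σ+it,χ) M(½+it,χ)|² Φ(t) dt`.
[cite: ConreyIwaniecSoundararajan2011CriticalZeros, §1 (1.10)] -/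
def mollifiedMoment (r X σ : ℝ) (Φ : ℝ → ℝ) (χ : DirichletCharacter ℂ q) : ℝ :=
  ∫ t : ℝ, ‖levinsonG r χ ((σ : ℂ) + (t : ℂ) * I) *
      mollifier X χ ((1 / 2 : ℂ) + (t : ℂ) * I)‖ ^ 2 * Φ t

end OneCharacter

/-! ### Weights -/

/-- "`Ψ(x)` a non-negative function, smooth, compactly supported on `ℝ⁺`": `Ψ ∈ C^∞(ℝ)`, `Ψ ≥ 0`,
`tsupport Ψ ⊆ [c₁, c₂]` with `0 < c₁`. [cite: ConreyIwaniecSoundararajan2011CriticalZeros, §1 (before (1.4))] -/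
def IsNonnegFamilyWeight (Ψ : ℝ → ℝ) : Prop :=
  ContDiff ℝ ∞ Ψ ∧ (∀ x, 0 ≤ Ψ x) ∧ ∃ c₁ c₂ : ℝ, 0 < c₁ ∧ tsupport Ψ ⊆ Set.Icc c₁ c₂

/-- The class of smoothing weights `Φ` at height `T` with constants table `c` — (1.11)–(1.12):
`Φ ∈ C^∞(ℝ)`, `Φ ≥ 0`, and `|(1+|t|)^j Φ^{(j)}(t)| ≤ c(j,A) · (1 + |t|/T)^{−A}` for all `j, A ∈ ℕ`
("the implied constant depending on `j` and `A`" made explicit as the table `c`).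
[cite: ConreyIwaniecSoundararajan2011CriticalZeros, §1 (1.11)–(1.12)] -/
def IsHeightWeight (T : ℝ) (c : ℕ → ℕ → ℝ) (Φ : ℝ → ℝ) : Prop :=
  ContDiff ℝ ∞ Φ ∧ (∀ t, 0 ≤ Φ t) ∧
    ∀ j A : ℕ, ∀ t : ℝ,
      |(1 + |t|) ^ j * iteratedDeriv j Φ t| ≤ c j A / (1 + |t| / T) ^ A

/-! ### Family sums over primitive characters of conductor `q ≍ Q` -/

/-- `𝒩(T,Q) = Σ_q Ψ(q/Q) φ(q)⁻¹ Σ*_{χ (mod q)} N(T,χ)` (1.4) (the `q`-sum as a `finsum` over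
`q = k+1`; finite for compactly supported `Ψ`).
[cite: ConreyIwaniecSoundararajan2011CriticalZeros, §1 (1.4)] -/
def familyZeroCount (Ψ : ℝ → ℝ) (Q T : ℝ) : ℝ :=
  ∑ᶠ k : ℕ, Ψ (((k + 1 : ℕ) : ℝ) / Q) / (Nat.totient (k + 1) : ℝ) *
    ∑ χ : DirichletCharacter ℂ (k + 1) with χ.IsPrimitive, (zeroCount χ T : ℝ)

/-- `𝒩₀′(T,Q)`: the same sum with `N(T,χ)` replaced by `N₀′(T,χ)`.
[cite: ConreyIwaniecSoundararajan2011CriticalZeros, §1 (after (1.4))] -/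
def familySimpleCriticalZeroCount (Ψ : ℝ → ℝ) (Q T : ℝ) : ℝ :=
  ∑ᶠ k : ℕ, Ψ (((k + 1 : ℕ) : ℝ) / Q) / (Nat.totient (k + 1) : ℝ) *
    ∑ χ : DirichletCharacter ℂ (k + 1) with χ.IsPrimitive, (simpleCriticalZeroCount χ T : ℝ)

/-- The left-hand side of (1.17): `Σ_q Ψ(q/Q) φ(q)⁻¹ Σ*_{χ (mod q)} I_χ` with, for each modulus `q`,
`X = 𝐪^θ`, `λ = 1/(r log 𝐪)`, `σ = ½ − R/log 𝐪` (`𝐪 = q/π`).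
[cite: ConreyIwaniecSoundararajan2011CriticalZeros, Theorem 2 (1.17) left side] -/
def familyMollifiedMoment (Ψ : ℝ → ℝ) (Q θ r R : ℝ) (Φ : ℝ → ℝ) : ℝ :=
  ∑ᶠ k : ℕ, Ψ (((k + 1 : ℕ) : ℝ) / Q) / (Nat.totient (k + 1) : ℝ) *
    ∑ χ : DirichletCharacter ℂ (k + 1) with χ.IsPrimitive,
      mollifiedMoment r (boldQ (k + 1) ^ θ) (1 / 2 - R / Real.log (boldQ (k + 1))) Φ χ

/-- The weighted size of the family, `Σ_q Ψ(q/Q) φ*(q)/φ(q)` (right-hand side of (1.17); `φ*(q)` =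
the number of primitive characters mod `q`, (1.14)).
[cite: ConreyIwaniecSoundararajan2011CriticalZeros, §1 (1.14), (1.17) right side] -/
def familyMass (Ψ : ℝ → ℝ) (Q : ℝ) : ℝ :=
  ∑ᶠ k : ℕ, Ψ (((k + 1 : ℕ) : ℝ) / Q) / (Nat.totient (k + 1) : ℝ) *
    ((Finset.univ.filter fun χ : DirichletCharacter ℂ (k + 1) => χ.IsPrimitive).card : ℝ)

/-! ### The constants `C`, `C*`, `c(θ,r,R)`, `κ′` -/

/-- `C(θ,r,R) = −(r²/2 + 1/(4R²))(1/(θR) + θR/3) + r²/2 − (r/(2R))(1/(θR) − θR/3)` (1.19).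
[cite: ConreyIwaniecSoundararajan2011CriticalZeros, Theorem 2 (1.19)] -/
def bigC (θ r R : ℝ) : ℝ :=
  -(r ^ 2 / 2 + 1 / (4 * R ^ 2)) * (1 / (θ * R) + θ * R / 3) + r ^ 2 / 2 -
    r / (2 * R) * (1 / (θ * R) - θ * R / 3)

/-- `C*(θ,r,R)` "is obtained from `C(θ,r,R)` by changing `r, R` to `1−r, −R` respectively" — this IS
the definition; the printed closed form (1.20) is `bigCStar_eq`.
[cite: ConreyIwaniecSoundararajan2011CriticalZeros, Theorem 2 (1.20)] -/
def bigCStar (θ r R : ℝ) : ℝ :=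
  bigC θ (1 - r) (-R)

/-- The mean value `c(θ,r,R)`: `r² c(θ,r,R) = C(θ,r,R) + e^{2R} C*(θ,r,R)` (1.18).
[cite: ConreyIwaniecSoundararajan2011CriticalZeros, Theorem 2 (1.18)] -/
def meanValueConst (θ r R : ℝ) : ℝ :=
  (bigC θ r R + Real.exp (2 * R) * bigCStar θ r R) / r ^ 2

/-- Levinson's proportion `κ′ = 1 − (1/R) log c(θ,r,R)` (1.25).
[cite: ConreyIwaniecSoundararajan2011CriticalZeros, §1 (1.25)] -/
def levinsonKappa (θ r R : ℝ) : ℝ :=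
  1 - Real.log (meanValueConst θ r R) / R

/-- The printed closed form (1.20) of `C*`:
`C*(θ,r,R) = ((r−1)²/2 + 1/(4R²))(1/(θR) + θR/3) + (r−1)²/2 + ((r−1)/(2R))(1/(θR) − θR/3)`
(for `θ, R ≠ 0`, where all the fractions are meaningful).
[cite: ConreyIwaniecSoundararajan2011CriticalZeros, Theorem 2 (1.20)] -/
theorem bigCStar_eq {θ r R : ℝ} (hθ : θ ≠ 0) (hR : R ≠ 0) :
    bigCStar θ r R =
      ((r - 1) ^ 2 / 2 + 1 / (4 * R ^ 2)) * (1 / (θ * R) + θ * R / 3) + (r - 1) ^ 2 / 2 +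
        (r - 1) / (2 * R) * (1 / (θ * R) - θ * R / 3) := by
  unfold bigCStar bigC
  field_simp
  ring

/-- (1.18) solved for `c`: `r² · c(θ,r,R) = C + e^{2R} C*` (for `r ≠ 0`).
[cite: ConreyIwaniecSoundararajan2011CriticalZeros, Theorem 2 (1.18)] -/
theorem sq_mul_meanValueConst {θ r R : ℝ} (hr : r ≠ 0) :
    r ^ 2 * meanValueConst θ r R = bigC θ r R + Real.exp (2 * R) * bigCStar θ r R := by
  unfold meanValueConst
  field_simp

/-! ### The named facts -/

/-- **Conrey–Iwaniec–Soundararajan, Critical zeros of Dirichlet `L`-functions, Theorem 1** (display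
(1.5)). For every non-negative smooth `Ψ` compactly supported in `(0,∞)` and every constant `A ≥ 6`
there is `Q₀ = Q₀(A, Ψ)` such that for all `Q ≥ Q₀` and all `T` with `(log Q)^6 ≤ T ≤ (log Q)^A`:
`𝒩₀′(T,Q) ≥ (14/25)·𝒩(T,Q)` — on average over primitive `χ (mod q)` and `q ≍ Q`, at least `56%` of the
zeros of `L(s,χ)` up to height `T` are simple and on the critical line. Status: theorem-in-print
(named fact, not proved here). [cite: ConreyIwaniecSoundararajan2011CriticalZeros, Theorem 1 (1.5)] -/
def conreyIwaniecSoundararajanCriticalZeros_theorem1 : Prop :=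
  ∀ Ψ : ℝ → ℝ, IsNonnegFamilyWeight Ψ → ∀ A : ℝ, 6 ≤ A →
    ∃ Q₀ : ℝ, ∀ Q T : ℝ, Q₀ ≤ Q → Real.log Q ^ (6 : ℝ) ≤ T → T ≤ Real.log Q ^ A →
      (14 / 25 : ℝ) * familyZeroCount Ψ Q T ≤ familySimpleCriticalZeroCount Ψ Q T

/-- **Conrey–Iwaniec–Soundararajan, Critical zeros of Dirichlet `L`-functions, Theorem 2** (display
(1.17); the mollified second moment with the LINEAR mollifier (1.16) of length `X = 𝐪^θ`,
`0 < θ < 1`). Let `0 < θ < 1`, `r > 0`, `R > 0`, `λ = 1/(r log 𝐪)`, `σ = ½ − R/log 𝐪`, and `A ≥ 6`.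
Then, uniformly for `(log Q)^6 ≤ T ≤ (log Q)^A` and for smoothing weights `Φ` at height `T` in the
class (1.11)–(1.12) (fixed constants table `c`) with `Φ̂(1) ≥ c₁T`,
`Σ_q Ψ(q/Q)/φ(q) Σ*_{χ (mod q)} I_χ = (c(θ,r,R) + o(1)) · Φ̂(1) · Σ_q Ψ(q/Q) φ*(q)/φ(q)` as `Q → ∞`,
with `c(θ,r,R)` the closed form (1.18)–(1.20) (`meanValueConst`). Typed as: for every `ε > 0` there
is `Q₀` (depending on `Ψ, θ, r, R, A, c, c₁, ε`) beyond which the two sides differ by at most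
`ε · Φ̂(1) · Σ_q Ψ(q/Q) φ*(q)/φ(q)`. Status: theorem-in-print (named fact).
[cite: ConreyIwaniecSoundararajan2011CriticalZeros, Theorem 2 (1.16)–(1.20)] -/
def conreyIwaniecSoundararajanCriticalZeros_theorem2 : Prop :=
  ∀ Ψ : ℝ → ℝ, IsNonnegFamilyWeight Ψ →
    ∀ θ r R A : ℝ, 0 < θ → θ < 1 → 0 < r → 0 < R → 6 ≤ A →
      ∀ c : ℕ → ℕ → ℝ, ∀ c₁ : ℝ, 0 < c₁ →
        ∀ ε : ℝ, 0 < ε →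
          ∃ Q₀ : ℝ, ∀ Q T : ℝ, Q₀ ≤ Q → Real.log Q ^ (6 : ℝ) ≤ T → T ≤ Real.log Q ^ A →
            ∀ Φ : ℝ → ℝ, IsHeightWeight T c Φ → c₁ * T ≤ ∫ t, Φ t →
              |familyMollifiedMoment Ψ Q θ r R Φ -
                  meanValueConst θ r R * (∫ t, Φ t) * familyMass Ψ Q| ≤
                ε * (∫ t, Φ t) * familyMass Ψ Q

/-- **The Levinson deduction (1.24)–(1.25)** ("By Corollary A in the last section we get"): for the
parameters of Theorem 2 (`0 < θ < 1`, `r, R > 0`; with `c(θ,r,R) > 0`, "Definitely `c > 1`") and any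
`A ≥ 6`, `𝒩₀′(T,Q) ≥ (κ′ + o(1)) 𝒩(T,Q)` for `(log Q)^6 ≤ T ≤ (log Q)^A`, `Q → ∞`, where
`κ′ = 1 − (1/R) log c(θ,r,R)` (`levinsonKappa`) — typed as: for every `ε > 0` there is `Q₀` with
`(κ′ − ε)·𝒩(T,Q) ≤ 𝒩₀′(T,Q)` beyond it. This is the parametric form of which Theorem 1 is the instance
"`θ = 1`, `r = 10/9`, `R = 0.83` … `κ′ = 0.56001…`" (numerics not certified here). Status:
theorem-in-print (named fact). [cite: ConreyIwaniecSoundararajan2011CriticalZeros, §1 (1.24)–(1.25)] -/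
def conreyIwaniecSoundararajanCriticalZeros_levinsonBound : Prop :=
  ∀ Ψ : ℝ → ℝ, IsNonnegFamilyWeight Ψ →
    ∀ θ r R A : ℝ, 0 < θ → θ < 1 → 0 < r → 0 < R → 6 ≤ A → 0 < meanValueConst θ r R →
      ∀ ε : ℝ, 0 < ε →
        ∃ Q₀ : ℝ, ∀ Q T : ℝ, Q₀ ≤ Q → Real.log Q ^ (6 : ℝ) ≤ T → T ≤ Real.log Q ^ A →
          (levinsonKappa θ r R - ε) * familyZeroCount Ψ Q T ≤ familySimpleCriticalZeroCount Ψ Q T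

/-! ### Bookkeeping (proved) -/

/-- If the Levinson bound (1.24) holds and `κ′(θ,r,R) > 14/25` for some admissible `(θ,r,R)` with
`c(θ,r,R) > 0`, then Theorem 1's conclusion holds (take `ε = κ′ − 14/25`). This is the printed
route "Theorem 2 ⇒ (1.24) ⇒ Theorem 1", with the numerical input
`κ′ > 0.56` isolated as a hypothesis. [cite: ConreyIwaniecSoundararajan2011CriticalZeros, §1 (1.24)–(1.25)
and the sentence after them] -/
theorem theorem1_of_levinsonBound (h : conreyIwaniecSoundararajanCriticalZeros_levinsonBound)
    {θ r R : ℝ} (hθ : 0 < θ) (hθ1 : θ < 1) (hr : 0 < r) (hR : 0 < R)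
    (hc : 0 < meanValueConst θ r R) (hκ : (14 / 25 : ℝ) < levinsonKappa θ r R) :
    conreyIwaniecSoundararajanCriticalZeros_theorem1 := by
  intro Ψ hΨ A hA
  obtain ⟨Q₀, hQ₀⟩ := h Ψ hΨ θ r R A hθ hθ1 hr hR hA hc (levinsonKappa θ r R - 14 / 25)
    (by linarith)
  refine ⟨Q₀, fun Q T hQ hT1 hT2 => ?_⟩
  have key := hQ₀ Q T hQ hT1 hT2
  have hsimp : levinsonKappa θ r R - (levinsonKappa θ r R - 14 / 25) = 14 / 25 := by ring
  rw [hsimp] at key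
  exact key

end CISCriticalZeros

end Literature.NumberTheory.LFunctions

end
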